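import Summits.QuantumFields.YangMills.Theorems.BalabanUVNodesPortS1G3CParamRecord

/-!
# NODE O port PT-A — `stub_G3C` (repaired edition `G3CAtRecordL`), layer (D4b): THE COLLECTOR — a GERM-FREE row (g1)

Memo §5c (hand `hand-27930-G3C` g0, v1.5): the germ `recordPairJ B` is known to lie in the record spaces only under the TokP9-reg hypothesis, which `G3CAtRecordL` does not
carry; so row (g1) of `G3CPiecesAt` (the resummed representation AT THE GERM) is met by bookkeeping instead: the whole torus `X_full := ⟨univ, _⟩` is a localization domain
lying IN the centred wrap class (so row (gZ) asks nothing of it), and the COLLECTOR `collect a W t := W` off `a`, `:= t − Σ_{X ≠ a} W X` at `a` has `Σ_X collect a W t X = t` for every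
input and equals `W` wherever `Σ_X W X = t` already holds (on the open sets where the expansion is valid).  Cell `ym-nodeO-ideate`; definition kind (two small `def`s),
`--supports stmt-QuantumFields-27930 --as helper`; count-neutral.

WHAT THIS FILE PROVES (sorry-free): `G3CGeom.tlinked_univ_update_add_nat`, `tlinked_univ_update`, `tlinked_univ`, ★ `G3CGeom.isTDom_univ'` (the torus is a domain; cf. the
B16-based ✓`…N18TorusDomainCover.isTDom_univ`, not imported to keep the closure small); `g3cFull` + `mem_g3cFull`, ★ `g3cFull_mem_recordWrapCtr`; generic `G3CInv.collect` +
`collect_of_ne`, `collect_self`, ★ `sum_collect`, ★ `collect_eq_self_of_sum_eq`.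

HONEST FRAMING.  Bookkeeping only; nothing of Bałaban asserted, ported or discharged; `stub_G3C` NOT closed; 27930 OPEN; NODE O 0∕1; COUNT 8∕28 · K 1∕4 UNMOVED; finite `𝕋⁴_{L^K}` at
fixed ε — NOT continuum ∕ OS ∕ Clay; **the Yang–Mills mass gap is NOT proved by any of this.**  No `sorry`, no `instance`, no `notation`; standard axioms.
-/

noncomputable section

open scoped BigOperators
open Finset

namespace Summit.QuantumFields.YangMills.Theorems.BalabanUVNodesPortS1

open Summit.QuantumFields.YangMills.Theorems.K0RecordFormatNames
open Literature.MathematicalPhysics.QuantumFieldTheory.Balaban1983to89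
open Literature.MathematicalPhysics.QuantumFieldTheory.Balaban1983to89.Node00
open Literature.MathematicalPhysics.QuantumFieldTheory.Balaban1983to89.T4Continuum (T4Family)
open Literature.MathematicalPhysics.QuantumFieldTheory.Balaban1983to89.TreeLengthTorus (TPt TAdj TStepIn TLinked TFaceConnected IsTDom)

/-! ## The whole torus is a localization domain (direct coordinate stepping) -/

namespace G3CGeom

variable {d N : ℕ}

/-- Stepping `m` times in direction `i` stays linked inside `univ`. [folklore] -/
theorem tlinked_univ_update_add_nat [NeZero N] (x : TPt d N) (i : Fin d) (m : ℕ) :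
    TLinked (Finset.univ : Finset (TPt d N)) x (Function.update x i (x i + m)) := by
  induction m with
  | zero =>
      have : Function.update x i (x i + ((0 : ℕ) : ZMod N)) = x := by simp
      rw [this]; exact Relation.ReflTransGen.refl
  | succ m ih =>
      refine Relation.ReflTransGen.tail ih ⟨Finset.mem_univ _, Finset.mem_univ _, ⟨i, Or.inl ?_⟩⟩
      simp only [Function.update_self, Function.update_idem, Nat.cast_succ, add_assoc]

/-- Changing one coordinate stays linked inside `univ`. [folklore] -/
theorem tlinked_univ_update [NeZero N] (x : TPt d N) (i : Fin d) (v : ZMod N) :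
    TLinked (Finset.univ : Finset (TPt d N)) x (Function.update x i v) := by
  have h := tlinked_univ_update_add_nat x i (v - x i).val
  rwa [ZMod.natCast_zmod_val, add_sub_cancel] at h

/-- Any two cube indices of the torus are linked inside `univ`. [folklore] -/
theorem tlinked_univ [NeZero N] (x y : TPt d N) : TLinked (Finset.univ : Finset (TPt d N)) x y := by
  classical
  suffices h : ∀ s : Finset (Fin d), TLinked (Finset.univ : Finset (TPt d N)) x (fun i => if i ∈ s then y i else x i) by
    have := h Finset.univ
    simpa using this
  intro s
  induction s using Finset.induction_on with
  | empty => simp only [Finset.notMem_empty, if_false]; exact Relation.ReflTransGen.refl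
  | insert a s ha ih =>
      have e : (fun i => if i ∈ insert a s then y i else x i) = Function.update (fun i => if i ∈ s then y i else x i) a (y a) := by
        funext i
        by_cases hi : i = a
        · subst hi; simp
        · rw [Function.update_of_ne hi]; simp [Finset.mem_insert, hi]
      rw [e]
      exact ih.trans (tlinked_univ_update _ a (y a))

/-- ★ **The whole torus is a localization domain** (non-empty, wall-connected). [cite: Balaban1987RG1, p.257 (localization domains; the torus `T` is the largest `X ∈ 𝐃_j`)] -/
theorem isTDom_univ' [NeZero N] : IsTDom (Finset.univ : Finset (TPt d N)) :=
  ⟨⟨fun _ => 0, Finset.mem_univ _⟩, fun x _ y _ => tlinked_univ x y⟩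

end G3CGeom

/-! ## The whole-torus domain of the record and its wrap-class membership -/

section Full

variable (F : T4Family)

/-- **`X_full`** — the whole torus as a domain of `𝐃_{k+1}(T_K)` (the collector's seat). [cite: Balaban1987RG1, p.257 (localization domains)] -/
def g3cFull (Mc k K : ℕ) : (recordDomSys F Mc k K).Dom :=
  ⟨Finset.univ, G3CGeom.isTDom_univ'⟩

/-- Every cube lies in `X_full`. [folklore] -/
theorem mem_g3cFull (Mc k K : ℕ) (c : TPt (F.P K).d (Sect2.domCount (F.P K) Mc (k + 1))) : c ∈ ((g3cFull F Mc k K).1 : Finset _) :=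
  Finset.mem_univ c

/-- ★ **`X_full` lies in the centred wrap class**: the cube with all indices `⌊q∕2⌋` is on the antipodal seam — so row (gZ) (stated OFF `recordWrapCtr`) never reads the collector's piece.
[cite: Balaban1987RG1, (1.21) p.264 (bookkeeping)] -/
theorem g3cFull_mem_recordWrapCtr (Mc k K : ℕ) : g3cFull F Mc k K ∈ recordWrapCtr F Mc k K := by
  classical
  rw [recordWrapCtr, Finset.mem_filter]
  refine ⟨Finset.mem_univ _, fun _ => ((Sect2.domCount (F.P K) Mc (k + 1) / 2 : ℕ) : ZMod _), mem_g3cFull F Mc k K _, ⟨⟨0, by have := (F.P K).hd; omega⟩, ?_⟩⟩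
  exact ZMod.valMinAbs_natCast_of_le_half le_rfl

end Full

/-! ## The collector -/

namespace G3CInv

variable {α : Type*} [Fintype α] [DecidableEq α]

/-- **The collector**: `W` off the seat `a`, and `t − Σ_{X ≠ a} W X` at `a`. [folklore] -/
def collect (a : α) (W : α → ℂ) (t : ℂ) : α → ℂ := fun X => if X = a then t - ∑ Y ∈ Finset.univ.erase a, W Y else W X

/-- Off the seat the collector is `W`. [folklore] -/
theorem collect_of_ne {a X : α} (h : X ≠ a) (W : α → ℂ) (t : ℂ) : collect a W t X = W X := by
  rw [collect, if_neg h]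

/-- At the seat the collector is `t − Σ_{X ≠ a} W X`. [folklore] -/
theorem collect_self (a : α) (W : α → ℂ) (t : ℂ) : collect a W t a = t - ∑ Y ∈ Finset.univ.erase a, W Y := by
  rw [collect, if_pos rfl]

/-- ★ **The collector sums to `t`**, whatever `W` is. [folklore] -/
theorem sum_collect (a : α) (W : α → ℂ) (t : ℂ) : ∑ X, collect a W t X = t := by
  rw [← Finset.add_sum_erase _ _ (Finset.mem_univ a), collect_self]
  have : ∑ X ∈ Finset.univ.erase a, collect a W t X = ∑ X ∈ Finset.univ.erase a, W X :=
    Finset.sum_congr rfl fun X hX => collect_of_ne (Finset.ne_of_mem_erase hX) W t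
  rw [this]; ring

/-- ★ **Where `W` already sums to `t`, the collector IS `W`.** [folklore] -/
theorem collect_eq_self_of_sum_eq {a : α} {W : α → ℂ} {t : ℂ} (h : ∑ X, W X = t) (X : α) : collect a W t X = W X := by
  by_cases hX : X = a
  · subst hX
    rw [collect_self, ← h, ← Finset.add_sum_erase _ _ (Finset.mem_univ X)]; ring
  · exact collect_of_ne hX W t

end G3CInv

end Summit.QuantumFields.YangMills.Theorems.BalabanUVNodesPortS1

end
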